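import Summits.AtomisticToContinuum.HydrodynamicLimit.Theorems.OneFlightGossipEngineEquilibriumClampedCollisionalWindowLDDefs
import Summits.AtomisticToContinuum.HydrodynamicLimit.Theorems.TwoClocksClampedTransferWindowLDStubIsolatedShellDominationLegs

/-!
# Rung R7 of line `Sketch` — isolated-shell domination (crux `TwoClocks.ClampedTransferWindowLD`, stmt-AtomisticToContinuum-16623)

Helper file (`--supports stmt-AtomisticToContinuum-16623`) of the line lead, proving the registered stub
`SketchLine.stub_isolatedShellDomination` (R7 of the lead-owned skeleton `Cruxes/ClampedTransferWindowLD/Lines/Sketch.lean`, v4;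
card `Ideas/clamp-price-static-shell.md`, first lemma `IsolatedShellDomination`; pathwise, no probability).

On a good orbit of `N + 1` hard spheres of diameter `ε = hsDiameter σ N < 1/8` on `𝕋³`, the window TRANSFER ACTIVITY of particle
`i` carried by its ISOLATED binary records `c` in `(0, w]` (`c.fst = i`, inbound leg inside the window `2ε ≤ ‖g‖ c.time`,
`g = v_i⁻ - v_j⁻`, no third sphere within `3ε` of `i` or of `j = c.snd` during `[c.time - 2ε/‖g‖, c.time]`) is dominated by the
window average of the static near-contact SHELL RATE of `i`,
`shellRate_i(y) = Σ_{j ≠ i, ε < ‖sep(x_i, x_j)‖ < 2ε} ‖v_i - v_j‖² (1 + ‖v_i + v_j‖/2)`: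

  `(σ/τ) Σ_{isolated c} impulse c ≤ w⁻¹ ∫⁻_{(0, w]} shellRate_i(Φ_t z) dt`.

Proof (legs from `…StubIsolatedShellDominationLegs`): per isolated record, `ε · impulse c ≤ ε ‖g‖ (1 + ‖v_i⁻ + v_j⁻‖/2)`
(`isoShell_impulse_le`) `= ∫_{leg} ‖g‖² (1 + ‖v_i⁻ + v_j⁻‖/2)` over the leg `(c.time - ε/‖g‖, c.time)`, on which `j` is in the
shell of `i` with the incoming velocities (`isoShell_leg`), so the shell rate is at least the integrand (`isoShell_leg_lintegral`,
other shell terms `≥ 0`); the legs of distinct isolated records of `i` are pairwise disjoint (`isoShell_leg_disjoint`: a record of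
`i` inside another record's leg window would be a collision of `i` there, excluded by `isoShell_free`) and lie in `(0, w]`; hence
`ε Σ impulse ≤ ∫⁻_{(0,w]} shellRate` (`isoShell_sum_le_lintegral`: `lintegral_biUnion_finset` + `lintegral_mono_set`, no
measurability of the integrand needed), and `σ/τ = ε/w` (`hsDiameter_mul_div`). The stub is the general statement
`isoShell_domination` (any guard `P` implying isolation) read on its own guard.
-/

noncomputable section

open MeasureTheory ProbabilityTheory Set Filter
open scoped ENNReal BigOperators
open Literature.Analysis.FluidPDE Literature.MathematicalPhysics.KineticTheory
open Literature.Analysis.FunctionSpaces (Torus.partialDeriv Torus.IsSmooth)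

namespace Summit.AtomisticToContinuum.HydrodynamicLimit.Theorems.ClampedTransferCoin.SketchLine

open HardSphereCollisionRecord

/-! ## Elementary pieces -/

/-- The guard `2ε ≤ ‖g‖ t` of an isolated record forces `g ≠ 0` (`ε > 0`). -/
theorem isoShell_norm_pos_of_guard {ε t : ℝ} {g : V3} (hε : 0 < ε) (h : 2 * ε ≤ ‖g‖ * t) : 0 < ‖g‖ := by
  rcases (norm_nonneg g).lt_or_eq with hlt | heq
  · exact hlt
  · rw [← heq, zero_mul] at h
    linarith

/-- The leg `(t - ε/‖g‖, t)` of a guarded record with `t ≤ w` lies in the window `(0, w]`. -/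
theorem isoShell_leg_subset {ε t w : ℝ} {g : V3} (hε : 0 < ε) (hg : 0 < ‖g‖) (h : 2 * ε ≤ ‖g‖ * t) (htw : t ≤ w) :
    Ioo (t - ε / ‖g‖) t ⊆ Ioc 0 w := by
  intro s hs
  have h2 : 2 * ε / ‖g‖ ≤ t := by rw [div_le_iff₀ hg]; linarith
  have h1 : ε / ‖g‖ ≤ 2 * ε / ‖g‖ := div_le_div_of_nonneg_right (by linarith) hg.le
  exact ⟨by linarith [hs.1], hs.2.le.trans htw⟩

/-- **Summing disjoint legs.** If nonnegative reals `a t p` (`t ∈ T`, `p ∈ Q t`) satisfy `ofReal (a t p) ≤ ∫⁻_{leg t p} f` for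
measurable, pairwise disjoint legs `leg t p ⊆ S`, then `ofReal (Σ_t Σ_p a t p) ≤ ∫⁻_S f` (no measurability of `f`). -/
theorem isoShell_sum_le_lintegral {κ : Type*} (T : Finset ℝ) (Q : ℝ → Finset κ) (a : ℝ → κ → ℝ)
    (leg : ℝ → κ → Set ℝ) (f : ℝ → ℝ≥0∞) (S : Set ℝ)
    (ha : ∀ t ∈ T, ∀ p ∈ Q t, 0 ≤ a t p)
    (hle : ∀ t ∈ T, ∀ p ∈ Q t, ENNReal.ofReal (a t p) ≤ ∫⁻ s in leg t p, f s)
    (hmeas : ∀ t ∈ T, ∀ p ∈ Q t, MeasurableSet (leg t p))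
    (hsub : ∀ t ∈ T, ∀ p ∈ Q t, leg t p ⊆ S)
    (hdisj : ∀ t ∈ T, ∀ p ∈ Q t, ∀ t' ∈ T, ∀ p' ∈ Q t', (t ≠ t' ∨ p ≠ p') → Disjoint (leg t p) (leg t' p')) :
    ENNReal.ofReal (∑ t ∈ T, ∑ p ∈ Q t, a t p) ≤ ∫⁻ s in S, f s := by
  rw [Finset.sum_sigma', ENNReal.ofReal_sum_of_nonneg fun x hx =>
    ha x.1 (Finset.mem_sigma.1 hx).1 x.2 (Finset.mem_sigma.1 hx).2]
  have hd : Set.PairwiseDisjoint (↑(T.sigma fun t => Q t) : Set ((_ : ℝ) × κ)) fun x => leg x.1 x.2 := by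
    rintro ⟨t, p⟩ hx ⟨t', p'⟩ hx' hne
    have h1 := Finset.mem_sigma.1 (Finset.mem_coe.1 hx)
    have h2 := Finset.mem_sigma.1 (Finset.mem_coe.1 hx')
    refine hdisj t h1.1 p h1.2 t' h2.1 p' h2.2 ?_
    by_cases htt : t = t'
    · subst htt
      exact Or.inr fun hpp => hne (by rw [hpp])
    · exact Or.inl htt
  calc ∑ x ∈ T.sigma (fun t => Q t), ENNReal.ofReal (a x.1 x.2)
      ≤ ∑ x ∈ T.sigma (fun t => Q t), ∫⁻ s in leg x.1 x.2, f s :=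
        Finset.sum_le_sum fun x hx => hle x.1 (Finset.mem_sigma.1 hx).1 x.2 (Finset.mem_sigma.1 hx).2
    _ = ∫⁻ s in ⋃ x ∈ T.sigma (fun t => Q t), leg x.1 x.2, f s :=
        (lintegral_biUnion_finset hd (fun x hx => hmeas x.1 (Finset.mem_sigma.1 hx).1 x.2 (Finset.mem_sigma.1 hx).2) f).symm
    _ ≤ ∫⁻ s in S, f s :=
        lintegral_mono_set (Set.iUnion₂_subset fun x hx =>
          hsub x.1 (Finset.mem_sigma.1 hx).1 x.2 (Finset.mem_sigma.1 hx).2)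

/-! ## The leg of one isolated record carries its impulse -/

section Legs

variable {σ : ℝ} {N : ℕ} {Φ : Flow σ N} {z : Phase N}


open scoped Classical in
/-- **One leg.** For an isolated record `c` of `(i, j)` at `t_c` (`g = v_i⁻ - v_j⁻ ≠ 0`, no third sphere within `3ε` of `i`, `j`
on `[t_c - 2ε/‖g‖, t_c]`): `ε · impulse c ≤ ∫⁻_{(t_c - ε/‖g‖, t_c)} shellRate_i(Φ_s z) ds` — the leg has length `ε/‖g‖`, on it
the `j`-term of the shell rate is the constant `‖g‖² (1 + ‖v_i⁻ + v_j⁻‖/2)` (`isoShell_leg`), the other terms are `≥ 0`, and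
`impulse c ≤ ‖g‖ (1 + ‖v_i⁻ + v_j⁻‖/2)` (`isoShell_impulse_le`). -/
theorem isoShell_leg_lintegral (hz : z ∈ Φ.good) (hσ : 0 < σ) (hε8 : hsDiameter σ N < 8⁻¹) {i j : Fin (N + 1)}
    {tc : ℝ} (hp : (i, j) ∈ contactPairs (Torus.geometry (Fin 3)) (hsDiameter σ N) (Φ.flow tc z)) {c : Rec N}
    (hc : c = ofConfig (Torus.geometry (Fin 3)) (hsDiameter σ N) (Φ.flow tc z) tc i j) {g : V3} (hgc : c.preVel.1 - c.preVel.2 = g)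
    (hg : 0 < ‖g‖) {t0 : ℝ} (ht0 : t0 = tc - 2 * hsDiameter σ N / ‖g‖)
    (hiso : ∀ k : Fin (N + 1), k ≠ i → k ≠ j → ∀ t ∈ Icc t0 tc,
      3 * hsDiameter σ N < ‖(Torus.geometry (Fin 3)).sepVec (Φ.flow t z k).1 (Φ.flow t z i).1‖ ∧
      3 * hsDiameter σ N < ‖(Torus.geometry (Fin 3)).sepVec (Φ.flow t z k).1 (Φ.flow t z j).1‖) :
    ENNReal.ofReal (hsDiameter σ N * impulse c) ≤
      ∫⁻ s in Ioo (tc - hsDiameter σ N / ‖g‖) tc, ENNReal.ofReal (∑ l : Fin (N + 1),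
        if l ≠ i ∧ hsDiameter σ N < ‖(Torus.geometry (Fin 3)).sepVec (Φ.flow s z i).1 (Φ.flow s z l).1‖ ∧
            ‖(Torus.geometry (Fin 3)).sepVec (Φ.flow s z i).1 (Φ.flow s z l).1‖ < 2 * hsDiameter σ N
        then ‖(Φ.flow s z i).2 - (Φ.flow s z l).2‖ ^ 2 * (1 + ‖(Φ.flow s z i).2 + (Φ.flow s z l).2‖ / 2) else 0) := by
  have hε : 0 < hsDiameter σ N := hsDiameter_pos hσ N
  have hij : i ≠ j := (mem_contactPairs.1 hp).1
  -- the constant value of the `j`-term on the leg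
  set K := ‖g‖ ^ 2 * (1 + ‖c.preVel.1 + c.preVel.2‖ / 2) with hK
  have hK0 : 0 ≤ K := by positivity
  -- impulse bound
  have himp : impulse c ≤ ‖g‖ * (1 + ‖c.preVel.1 + c.preVel.2‖ / 2) := by
    have h := isoShell_impulse_le c (n := (Torus.geometry (Fin 3)).sepVec (Φ.flow tc z i).1 (Φ.flow tc z j).1)
      (by rw [hc, ofConfig_postVel, ofConfig_preVel, reflectVel_reflectVel])
    rwa [hgc] at h
  have hstep : ENNReal.ofReal (hsDiameter σ N * impulse c) ≤ ENNReal.ofReal (hsDiameter σ N / ‖g‖ * K) := by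
    refine ENNReal.ofReal_le_ofReal ?_
    calc hsDiameter σ N * impulse c ≤ hsDiameter σ N * (‖g‖ * (1 + ‖c.preVel.1 + c.preVel.2‖ / 2)) :=
        mul_le_mul_of_nonneg_left himp hε.le
      _ = hsDiameter σ N / ‖g‖ * K := by rw [hK]; field_simp
  refine hstep.trans ?_
  -- the constant integral over the leg
  have hvol : volume (Ioo (tc - hsDiameter σ N / ‖g‖) tc) = ENNReal.ofReal (hsDiameter σ N / ‖g‖) := by
    rw [Real.volume_Ioo]
    congr 1
    ring
  have hconst : ENNReal.ofReal (hsDiameter σ N / ‖g‖ * K) =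
      ∫⁻ _ in Ioo (tc - hsDiameter σ N / ‖g‖) tc, ENNReal.ofReal K := by
    rw [setLIntegral_const, hvol, ← ENNReal.ofReal_mul hK0, mul_comm]
  rw [hconst]
  refine setLIntegral_mono' measurableSet_Ioo fun s hs => ENNReal.ofReal_le_ofReal ?_
  -- pointwise on the leg: `K` is the `j`-term, the other terms are nonnegative
  obtain ⟨h1, h2, hvi, hvj⟩ := isoShell_leg hz hσ hε8 hp hc hgc hg ht0 hiso hs
  refine le_trans ?_ (Finset.single_le_sum (fun l _ => ?_) (Finset.mem_univ j))
  · rw [if_pos ⟨hij.symm, h1, h2⟩, hvi, hvj, hgc, hK]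
  · split_ifs
    · positivity
    · exact le_rfl

/-- **Legs of distinct isolated records of `i` are disjoint.** If `i` takes part in a collision at `t_c' < t_c` and `c` is an
isolated record of `(i, j)` at `t_c`, then `t_c' ≤ t_c - 2ε/‖g‖` (`isoShell_free`), so any interval `(t_c' - r', t_c')` is
disjoint from the leg `(t_c - ε/‖g‖, t_c)`. -/
theorem isoShell_leg_disjoint (hz : z ∈ Φ.good) (hσ : 0 < σ) (hε8 : hsDiameter σ N < 8⁻¹) {i j : Fin (N + 1)}
    {tc tc' r' : ℝ} (hlt : tc' < tc) (hp : (i, j) ∈ contactPairs (Torus.geometry (Fin 3)) (hsDiameter σ N) (Φ.flow tc z)) {c : Rec N}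
    (hc : c = ofConfig (Torus.geometry (Fin 3)) (hsDiameter σ N) (Φ.flow tc z) tc i j) {g : V3} (hgc : c.preVel.1 - c.preVel.2 = g)
    (hg : 0 < ‖g‖) {t0 : ℝ} (ht0 : t0 = tc - 2 * hsDiameter σ N / ‖g‖)
    (hiso : ∀ k : Fin (N + 1), k ≠ i → k ≠ j → ∀ t ∈ Icc t0 tc,
      3 * hsDiameter σ N < ‖(Torus.geometry (Fin 3)).sepVec (Φ.flow t z k).1 (Φ.flow t z i).1‖ ∧
      3 * hsDiameter σ N < ‖(Torus.geometry (Fin 3)).sepVec (Φ.flow t z k).1 (Φ.flow t z j).1‖)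
    (hpart : Participates (Torus.geometry (Fin 3)) (hsDiameter σ N) (Φ.flow tc' z) i) :
    Disjoint (Ioo (tc' - r') tc') (Ioo (tc - hsDiameter σ N / ‖g‖) tc) := by
  have hε : 0 < hsDiameter σ N := hsDiameter_pos hσ N
  -- `tc'` is not inside the free window `(t0, tc)`
  have hle : tc' ≤ t0 := by
    by_contra h
    exact (isoShell_free hz hσ hε8 hp hc hgc hg ht0 hiso ⟨not_le.1 h, hlt⟩).1 hpart
  have hr : 0 < hsDiameter σ N / ‖g‖ := div_pos hε hg
  have ht0' : t0 < tc - hsDiameter σ N / ‖g‖ := by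
    rw [ht0, mul_div_assoc]
    linarith
  exact Set.disjoint_left.2 fun s hs hs' => by linarith [hs.2, hs'.1]

end Legs

/-! ## The domination, for any guard implying isolation -/

open scoped Classical in
/-- **Isolated-shell domination, general guard.** On a good orbit (`0 < σ`, `0 < τ`, `hsDiameter σ N < 1/8`), for every
predicate `P` on records such that `P c` for the record `c` of an ordered contact pair `(a, b)` at time `t` forces `a = i`, the
guard `2ε ≤ ‖g‖ t` and the isolation of `(i, b)` on `[t - 2ε/‖g‖, t]`, the `P`-guarded transfer activity of the window is at
most `w⁻¹ ∫⁻_{(0, w]} shellRate_i(Φ_t z) dt`. -/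
theorem isoShell_domination {σ τ : ℝ} {N : ℕ} (hσ : 0 < σ) (hτ : 0 < τ) (hε8 : hsDiameter σ N < 8⁻¹)
    (Φ : Flow σ N) (i : Fin (N + 1)) {z : Phase N} (hz : z ∈ Φ.good) (P : Rec N → Prop) [DecidablePred P]
    (hP : ∀ (t : ℝ) (a b : Fin (N + 1)) (c : Rec N),
      c = ofConfig (Torus.geometry (Fin 3)) (hsDiameter σ N) (Φ.flow t z) t a b →
      (a, b) ∈ contactPairs (Torus.geometry (Fin 3)) (hsDiameter σ N) (Φ.flow t z) → P c →
        a = i ∧ 2 * hsDiameter σ N ≤ ‖c.preVel.1 - c.preVel.2‖ * t ∧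
          ∀ k : Fin (N + 1), k ≠ i → k ≠ b →
            ∀ s ∈ Set.Icc (t - 2 * hsDiameter σ N / ‖c.preVel.1 - c.preVel.2‖) t,
              3 * hsDiameter σ N < ‖(Torus.geometry (Fin 3)).sepVec (Φ.flow s z k).1 (Φ.flow s z i).1‖ ∧
              3 * hsDiameter σ N < ‖(Torus.geometry (Fin 3)).sepVec (Φ.flow s z k).1 (Φ.flow s z b).1‖) :
    ENNReal.ofReal (σ / τ * Φ.collisionSum (Set.Ioc 0 (window τ N)) (fun c => if P c then impulse c else 0) z) ≤
      (ENNReal.ofReal (window τ N))⁻¹ * ∫⁻ t in Set.Ioc 0 (window τ N), ENNReal.ofReal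
        (∑ j : Fin (N + 1), if j ≠ i ∧
            hsDiameter σ N < ‖(Torus.geometry (Fin 3)).sepVec (Φ.flow t z i).1 (Φ.flow t z j).1‖ ∧
            ‖(Torus.geometry (Fin 3)).sepVec (Φ.flow t z i).1 (Φ.flow t z j).1‖ < 2 * hsDiameter σ N
          then ‖(Φ.flow t z i).2 - (Φ.flow t z j).2‖ ^ 2 * (1 + ‖(Φ.flow t z i).2 + (Φ.flow t z j).2‖ / 2) else 0) := by
  have hε : 0 < hsDiameter σ N := hsDiameter_pos hσ N
  have hw : 0 < window τ N := window_pos hτ N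
  have htraj := Φ.isTrajectory z hz
  have hfin : (collisionTimes (Torus.geometry (Fin 3)) (hsDiameter σ N) (fun t => Φ.flow t z) ∩
      Set.Ioc 0 (window τ N)).Finite :=
    Φ.finite_collisionTimes_inter hz Set.Ioc_subset_Icc_self
  -- the collision sum is a finite sum; normalisation `σ/τ = ε/w`
  rw [HardSphereFlow.collisionSum_eq, collisionSum_eq_finset_sum hfin]
  have hnorm : ∀ S : ℝ, σ / τ * S = (window τ N)⁻¹ * (hsDiameter σ N * S) := fun S => by
    rw [← hsDiameter_mul_div σ τ hσ.ne' N]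
    have h1 : hsDiameter σ N ≠ 0 := hε.ne'
    have h2 : τ ≠ 0 := hτ.ne'
    have h3 : σ ≠ 0 := hσ.ne'
    field_simp
  rw [hnorm, ENNReal.ofReal_mul (inv_nonneg.2 hw.le), ENNReal.ofReal_inv_of_pos hw]
  gcongr
  rw [Finset.mul_sum]
  simp_rw [Finset.mul_sum]
  -- sum the legs
  refine isoShell_sum_le_lintegral _ _ _
    (fun t p => if P (ofConfig (Torus.geometry (Fin 3)) (hsDiameter σ N) (Φ.flow t z) t p.1 p.2) then
      Set.Ioo (t - hsDiameter σ N /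
        ‖(ofConfig (Torus.geometry (Fin 3)) (hsDiameter σ N) (Φ.flow t z) t p.1 p.2).preVel.1 -
          (ofConfig (Torus.geometry (Fin 3)) (hsDiameter σ N) (Φ.flow t z) t p.1 p.2).preVel.2‖) t
      else ∅) _ _ ?_ ?_ ?_ ?_ ?_
  · -- nonnegative summands
    intro t _ p _
    exact mul_nonneg hε.le (AdaptedClampKinematics.ite_impulse_nonneg _ _)
  · -- each leg carries its impulse
    rintro t - ⟨a, b⟩ hab
    split_ifs with hPc
    · obtain ⟨rfl, hguard, hiso⟩ := hP t a b _ rfl hab hPc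
      have hg := isoShell_norm_pos_of_guard hε hguard
      exact isoShell_leg_lintegral hz hσ hε8 hab rfl rfl hg rfl hiso
    · simp
  · -- legs are measurable
    intro t _ p _
    split_ifs
    exacts [measurableSet_Ioo, MeasurableSet.empty]
  · -- legs lie in the window
    rintro t ht ⟨a, b⟩ hab
    have ht' : t ∈ Set.Ioc 0 (window τ N) := ((Set.Finite.mem_toFinset hfin).1 ht).2
    split_ifs with hPc
    · obtain ⟨rfl, hguard, -⟩ := hP t a b _ rfl hab hPc
      exact isoShell_leg_subset hε (isoShell_norm_pos_of_guard hε hguard) hguard ht'.2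
    · exact Set.empty_subset _
  · -- legs of distinct records are disjoint
    rintro t - ⟨a, b⟩ hab t' - ⟨a', b'⟩ hab' hne
    split_ifs with h1 h2
    · obtain ⟨rfl, hguard, hiso⟩ := hP t a b _ rfl hab h1
      obtain ⟨haa, hguard', hiso'⟩ := hP t' a' b' _ rfl hab' h2
      subst haa
      have hg := isoShell_norm_pos_of_guard hε hguard
      have hg' := isoShell_norm_pos_of_guard hε hguard'
      rcases lt_trichotomy t' t with hlt | heq | hgt
      · exact (isoShell_leg_disjoint hz hσ hε8 hlt hab rfl rfl hg rfl hiso ⟨b', Or.inl hab'⟩).symm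
      · subst heq
        have hbb : b' = b := htraj.eq_of_collide hab (Or.inl hab')
        subst hbb
        exact hne.elim (fun h => absurd rfl h) fun h => absurd rfl h
      · exact isoShell_leg_disjoint hz hσ hε8 hgt hab' rfl rfl hg' rfl hiso' ⟨b, Or.inl hab⟩
    · exact Set.disjoint_empty _
    · exact Set.empty_disjoint _
    · exact Set.disjoint_empty _

/-! ## The registered stub -/

open scoped Classical in
/-- **R7 · isolated-shell domination** (card `IsolatedShellDomination`, first lemma; pathwise, lintegral-in-time form). On a good orbit of
`N + 1` spheres of diameter `ε_N = hsDiameter σ N < 1/8`, the transfer activity of particle `i` carried by its ISOLATED binary records in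
`(0, w]` — records `c` with `c.fst = i`, inbound leg inside the window (`2 ε_N ≤ ‖g‖ · c.time`, `g = v_fst⁻ − v_snd⁻`), and no third
sphere within `3 ε_N` of `i` or of `c.snd` during `[c.time − 2ε_N/‖g‖, c.time]` — is at most `w⁻¹ ∫⁻₀ʷ shellRate_i(Φ_t z) dt`, where
`shellRate_i(y) = Σ_{j ≠ i, ε_N < ‖sep(x_i,x_j)‖ < 2ε_N} ‖v_i − v_j‖² (1 + ‖v_i + v_j‖/2)`. Per isolated record: the pair flies freely on
the leg window (isolation + "an outgoing pair never re-collides"), the backward flight from contact reaches `≥ √5 ε_N > 2ε_N`, the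
passage `2ε_N → ε_N` lasts `≥ ε_N/‖g‖` at constant velocities, and `ε_N (‖Δv_i‖ + |Δ‖v_i‖²|/2) ≤ ε_N ‖g‖ (1 + ‖v_i + v_j‖/2)`; leg
windows of distinct isolated records are disjoint; the other shell terms are `≥ 0`; `(σ/τ) / ε_N = w⁻¹`. (Classical `if`s: state and
prove it under `open scoped Classical in`, exactly as here.) -/
theorem stub_isolatedShellDomination :
    ∀ (σ τ : ℝ) (N : ℕ), 0 < σ → 0 < τ → hsDiameter σ N < 8⁻¹ →
      ∀ (Φ : Flow σ N) (i : Fin (N + 1)) (z : Phase N), z ∈ Φ.good →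
        ENNReal.ofReal (σ / τ * Φ.collisionSum (Set.Ioc 0 (window τ N)) (fun c =>
            if c.fst = i ∧ 2 * hsDiameter σ N ≤ ‖c.preVel.1 - c.preVel.2‖ * c.time ∧
                (∀ k : Fin (N + 1), k ≠ i → k ≠ c.snd →
                  ∀ t ∈ Set.Icc (c.time - 2 * hsDiameter σ N / ‖c.preVel.1 - c.preVel.2‖) c.time,
                    3 * hsDiameter σ N < ‖(Torus.geometry (Fin 3)).sepVec (Φ.flow t z k).1 (Φ.flow t z i).1‖ ∧
                    3 * hsDiameter σ N < ‖(Torus.geometry (Fin 3)).sepVec (Φ.flow t z k).1 (Φ.flow t z c.snd).1‖)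
            then impulse c else 0) z) ≤
          (ENNReal.ofReal (window τ N))⁻¹ * ∫⁻ t in Set.Ioc 0 (window τ N), ENNReal.ofReal
            (∑ j : Fin (N + 1), if j ≠ i ∧ hsDiameter σ N < ‖(Torus.geometry (Fin 3)).sepVec (Φ.flow t z i).1 (Φ.flow t z j).1‖ ∧
                ‖(Torus.geometry (Fin 3)).sepVec (Φ.flow t z i).1 (Φ.flow t z j).1‖ < 2 * hsDiameter σ N
              then ‖(Φ.flow t z i).2 - (Φ.flow t z j).2‖ ^ 2 * (1 + ‖(Φ.flow t z i).2 + (Φ.flow t z j).2‖ / 2) else 0) := by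
  intro σ τ N hσ hτ hε8 Φ i z hz
  exact isoShell_domination hσ hτ hε8 Φ i hz _ fun t a b c hc _ h => by subst hc; exact h

end Summit.AtomisticToContinuum.HydrodynamicLimit.Theorems.ClampedTransferCoin.SketchLine

end
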